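import Summits.BirchSwinnertonDyer.BirchSwinnertonDyer.Theorems.PrintCf2RubinValueTwoKatzMeasureJZeroSeamThetaDatumIntegrality
import Literature.NumberTheory.EllipticCurves.DeShalit1987.CMFormalActionReadingSeries
import Literature.NumberTheory.EllipticCurves.DivisionPointReadings
import Literature.NumberTheory.NumberFields.RayClassFieldLocalReadingField
import Literature.NumberTheory.GaloisRepresentations.LubinTateColemanRelativeLogDerivSurjModTwo
import Literature.NumberTheory.GaloisRepresentations.LubinTateComparisonUnramified
import HarnessLib

/-!
# `𝔓`-integrality of the model coordinates of division points of order prime to `v` — the CORE of the three oracles of the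
# `j = 0` seam (de Shalit II §4.9 (i); proofs only)

Cell `bsd-print-cf2`, width seat `bsd-line-cf2c-w4` g17; `--supports` the crux stmt-BirchSwinnertonDyer-20368 (helper, Theses-free).
THEOREMS ONLY; no `def`, no named fact, no `sorry`.

WHAT.  `KatzMeasureJZeroSeam.forall_moment_eq_of_label` ([I2] file 3a, width `-w8`) takes as HYPOTHESES three pointwise integrality
oracles on the lane curve `W = [1,−1,0,−2,−1]` with model lattice `Λ_L = Ω_E·w₀(𝓞_K)` at the split prime `v = (α₀) ∣ 2`:
for every integral `𝔠` with `v ∤ 𝔠` and every `𝔠`-division point `z ∈ 𝔠⁻¹L ∖ L`, and every reading field `F ⊇ e(K(𝔐))`,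
* `hIx`: an `X ∈ K(𝔐)` with `ι̂ X = ℘(z) − b₂/12` lies in the reading ring (`‖e X‖ ≤ 1`);
* `hIy`: a `Y ∈ K(𝔐)` with `ι̂ Y = (℘′(z) − a₁(℘(z) − b₂/12) − a₃)/2` lies in the reading ring;
* `hIu`: for two such points with `z₁ ± z₂ ∉ L`, `‖e(X₁ − X₂)‖ = 1`.
The sequel `…SeamIntegralityOracles` proves the three ∀-bodies VERBATIM; THIS FILE is their core, over RP-INT part 2
(`mem_readingRing_of_orbit`, `mem_readingRing_of_orbit_y`, p774779):
* §1 the CM ORBIT of a `𝔠`-division point, `v ∤ 𝔠`: `α₀ᵏz ∉ L` for all `k` (Bezout `(α₀ᵏ) + 𝔠 = 1`) and `α₀ⁿz ≡ z (mod L)` for some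
  `n > 0` (pigeonhole in the finite ring `𝓞_K/𝔠`);
* §2 the ORBIT READINGS generated inside `K(𝔐)` from `X` alone by the `[α₀]`-recursion `X_{k+1} = ((−1−w)X_k² + 2w − 2)/(4X_k + 3 − w)`
  (`CMTransformationPairSeven`: the denominator `Q̂` does not vanish off `ker [α₀]`), so that `hIx` needs no clause (vi);
* §3 the cores ★★ `mem_readingRing_of_mem_idealInvLattice` (`x(ξ z) ∈` reading ring) / `…_y`, and §4 the frame bookkeeping
  (`‖2‖ < 1`, `‖e(α₀)‖ < 1` in every reading field; `g₂ = 35/4`, `g₃ = 49/8`, `x = ℘ + ¼`, `y = (℘′ − x)/2` for `W`).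

HONEST FRAMING: plumbing of accepted kernel theorems; nothing is closed; no summit statement is proved by this seat; BSD is not proved by any of this.

## References
* [deShalit1987] E. de Shalit, *Iwasawa theory of elliptic curves with complex multiplication* (1987), II §1.10 (p. 39), II §4.9 (i) (p. 62–63).
* [SilvermanAEC2009] J. H. Silverman, *The Arithmetic of Elliptic Curves*, 2nd ed. (2009), VII.2.2, VII.3.1 (torsion injects into the reduction).
* [SerreLocalFields1979] J.-P. Serre, *Local Fields* (1979), Ch. II §2 (uniqueness of the extended absolute value).
-/

-- the summit namespace `Summit.BirchSwinnertonDyer.BirchSwinnertonDyer` repeats the problem name by design (D-0017)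
set_option linter.dupNamespace false
set_option autoImplicit false

noncomputable section

open scoped Classical NNReal
open scoped NumberField PeriodPair
open PeriodPair Literature.NumberTheory.EllipticCurves Literature.NumberTheory.EllipticCurves.DeShalit1987
  Literature.NumberTheory.EllipticCurves.DivisionPointReadings
open NumberField Field IsDedekindDomain IsDedekindDomain.HeightOneSpectrum ValuativeRel
open Literature.NumberTheory.NumberFields Literature.NumberTheory.ComplexMultiplication.EllipticUnits
open Literature.NumberTheory.GaloisRepresentations Literature.NumberTheory.GaloisRepresentations.IsNonarchimedeanLocalField
  Literature.NumberTheory.GaloisRepresentations.LubinTate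
open Polynomial _root_.WeierstrassCurve

namespace Summit.BirchSwinnertonDyer.BirchSwinnertonDyer.Theorems.PrintCf2.KatzMeasureJZeroSeam

attribute [local instance] ltNormUniformSpace ltNormIsUniformAddGroup rk1 nF nE fintypeResidueField

variable {K : Type} [Field K] [NumberField K]

/-! ## §1 The CM orbit of a `𝔠`-division point, `v ∤ 𝔠` -/

section Orbit

variable (ι : K →+* ℂ) (L : PeriodPair) {Ω : ℂ} (hL : ∀ z : ℂ, z ∈ L.lattice ↔ ∃ a : 𝓞 K, z = Ω * ι (a : K))

include hL in
omit [NumberField K] in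
/-- `Λ_L = Ω·ι(𝓞_K)` admits complex multiplication by `𝓞_K`. [cite: deShalit1987, II §2.3] -/
theorem isCMLattice_of_forall_mem_iff : IsCMLattice ι L.lattice := by
  intro a x hx
  obtain ⟨b, rfl⟩ := (hL x).mp hx
  exact (hL _).mpr ⟨a * b, by push_cast; rw [map_mul]; ring⟩

omit [NumberField K] in
/-- Bezout for `(α₀ᵏ) + 𝔠 = (1)`: if `v = (α₀)` does not divide `𝔠` (`v` maximal) then for every `k` there are `r ∈ 𝓞_K`, `c ∈ 𝔠` with
`r·α₀ᵏ + c = 1`. [cite: deShalit1987, II §4.9 (i)] -/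
theorem exists_mul_pow_add_eq_one {𝔭 𝔠 : Ideal (𝓞 K)} (h𝔭 : 𝔭.IsMaximal) (h𝔠𝔭 : ¬ 𝔠 ≤ 𝔭) {α₀ : 𝓞 K}
    (h𝔭α : 𝔭 = Ideal.span {α₀}) (k : ℕ) : ∃ r : 𝓞 K, ∃ c ∈ 𝔠, r * α₀ ^ k + c = 1 := by
  have hsup : 𝔭 ⊔ 𝔠 = ⊤ := by
    by_contra hne
    exact h𝔠𝔭 (le_of_le_of_eq le_sup_right (h𝔭.eq_of_le hne le_sup_left).symm)
  have hcop : IsCoprime 𝔭 𝔠 := Ideal.isCoprime_iff_sup_eq.mpr hsup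
  have hcopk : IsCoprime (𝔭 ^ k) 𝔠 := hcop.pow_left
  rw [h𝔭α, Ideal.span_singleton_pow] at hcopk
  obtain ⟨i, hi, c, hc, h1⟩ := Ideal.isCoprime_iff_exists.mp hcopk
  obtain ⟨r, rfl⟩ := Ideal.mem_span_singleton'.mp hi
  exact ⟨r, c, hc, h1⟩

include hL in
omit [NumberField K] in
/-- ★ **The CM orbit of a `𝔠`-division point avoids `L`**: for `z ∈ 𝔠⁻¹L ∖ L` with `v = (α₀) ∤ 𝔠`, `ι(α₀)ᵏ·z ∉ L` for every `k`
(`z = r·α₀ᵏz + c·z` with `c ∈ 𝔠`). [cite: deShalit1987, II §4.9 (i) (p. 62–63)] -/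
theorem pow_mul_notMem_of_mem_idealInvLattice {𝔭 𝔠 : Ideal (𝓞 K)} (h𝔭 : 𝔭.IsMaximal) (h𝔠𝔭 : ¬ 𝔠 ≤ 𝔭) {α₀ : 𝓞 K}
    (h𝔭α : 𝔭 = Ideal.span {α₀}) {z : ℂ} (hz : z ∈ idealInvLattice ι 𝔠 L.lattice) (hzL : z ∉ L.lattice) (k : ℕ) :
    ι (α₀ : K) ^ k * z ∉ L.lattice := by
  intro hk
  obtain ⟨r, c, hc, h1⟩ := exists_mul_pow_add_eq_one h𝔭 h𝔠𝔭 h𝔭α k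
  apply hzL
  have hcz : ι (c : K) * z ∈ L.lattice := (mem_idealInvLattice_iff.mp hz) c hc
  have hrz : ι (r : K) * (ι (α₀ : K) ^ k * z) ∈ L.lattice := isCMLattice_of_forall_mem_iff ι L hL r _ hk
  have e : z = ι (r : K) * (ι (α₀ : K) ^ k * z) + ι (c : K) * z := by
    have h1' : (r : K) * (α₀ : K) ^ k + (c : K) = 1 := by exact_mod_cast congrArg (fun x : 𝓞 K ↦ (x : K)) h1
    calc z = ι ((r : K) * (α₀ : K) ^ k + (c : K)) * z := by rw [h1', map_one, one_mul]
      _ = _ := by rw [map_add, map_mul, map_pow]; ring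
  rw [e]
  exact L.lattice.add_mem hrz hcz

omit [NumberField K] in
/-- **The CM orbit is periodic modulo `𝔠`**: for `𝔠 ≠ 0` with `v = (α₀) ∤ 𝔠` there is `n > 0` with `α₀ⁿ − 1 ∈ 𝔠` (pigeonhole in the
finite ring `𝓞_K/𝔠`, then cancel the unit `α₀` modulo `𝔠`). [cite: deShalit1987, II §4.9 (i) (p. 62–63)] -/
theorem exists_pow_sub_one_mem [NumberField K] {𝔭 𝔠 : Ideal (𝓞 K)} (h𝔭 : 𝔭.IsMaximal) (h𝔠𝔭 : ¬ 𝔠 ≤ 𝔭) (h𝔠 : 𝔠 ≠ ⊥) {α₀ : 𝓞 K}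
    (h𝔭α : 𝔭 = Ideal.span {α₀}) : ∃ n : ℕ, 0 < n ∧ α₀ ^ n - 1 ∈ 𝔠 := by
  haveI : Finite (𝓞 K ⧸ 𝔠) := Ideal.finiteQuotientOfFreeOfNeBot 𝔠 h𝔠
  obtain ⟨a, b, hab, heq⟩ := Finite.exists_ne_map_eq_of_infinite (fun k : ℕ ↦ Ideal.Quotient.mk 𝔠 (α₀ ^ k))
  -- arrange `a < b`
  wlog hlt : a < b generalizing a b
  · exact this b a hab.symm heq.symm (lt_of_le_of_ne (not_lt.mp hlt) hab.symm)
  refine ⟨b - a, Nat.sub_pos_of_lt hlt, ?_⟩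
  have hmem : α₀ ^ a - α₀ ^ b ∈ 𝔠 := Ideal.Quotient.eq.mp heq
  obtain ⟨r, c, hc, h1⟩ := exists_mul_pow_add_eq_one h𝔭 h𝔠𝔭 h𝔭α a
  have e : α₀ ^ (b - a) - 1 = -(r * (α₀ ^ a - α₀ ^ b)) + c * (α₀ ^ (b - a) - 1) := by
    have hb : α₀ ^ b = α₀ ^ a * α₀ ^ (b - a) := by rw [← pow_add, Nat.add_sub_cancel' hlt.le]
    rw [hb]
    linear_combination (-(α₀ ^ (b - a) - 1)) * h1
  rw [e]
  exact 𝔠.add_mem (𝔠.neg_mem (𝔠.mul_mem_left _ hmem)) (𝔠.mul_mem_right _ hc)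

omit [NumberField K] in
/-- ★ **Periodicity of the orbit in `ℂ/L`**: for `z ∈ 𝔠⁻¹L` and `α₀ⁿ − 1 ∈ 𝔠`, `ι(α₀)ⁿz − z ∈ L`. [cite: deShalit1987, II §4.9 (i) (p. 62–63)] -/
theorem pow_mul_sub_mem_of_mem_idealInvLattice {𝔠 : Ideal (𝓞 K)} {α₀ : 𝓞 K} {n : ℕ} (hn : α₀ ^ n - 1 ∈ 𝔠)
    {z : ℂ} (hz : z ∈ idealInvLattice ι 𝔠 L.lattice) : ι (α₀ : K) ^ n * z - z ∈ L.lattice := by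
  have h := (mem_idealInvLattice_iff.mp hz) _ hn
  have e : ι (((α₀ ^ n - 1 : 𝓞 K) : K)) * z = ι (α₀ : K) ^ n * z - z := by
    push_cast
    rw [map_sub, map_pow, map_one]; ring
  rwa [e] at h

end Orbit

/-! ## §2 The orbit readings generated from ONE reading by the `[α₀]`-recursion -/

omit [NumberField K] in
/-- ★ **Orbit readings from one reading**: if `X ∈ F ⊆ K̄` reads `℘(z) + ¼` and the orbit `ι(α₀)ᵏz` avoids `L` (model
`(g₂, g₃) = (35/4, 49/8)`, `ι(α₀)² = ι(α₀) − 2`), then the recursion `X_{k+1} = ((−1−w)X_k² + 2w − 2)/(4X_k + 3 − w)` (`w = α₀`) inside `F`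
produces `X_k ∈ F` reading `℘(ι(α₀)ᵏz) + ¼` for every `k` — the denominator `Q̂(X_k)` never vanishes off `ker [α₀]`
(`eval_seven_Qhat_ne_zero`). [cite: deShalit1987, II §1.10 (p. 39), II §4.9 (i)] [cite: SilvermanAEC2009, VI.3.6] -/
theorem exists_orbitReadings (ι : K →+* ℂ) (F : IntermediateField K (AlgebraicClosure K)) {α₀ : 𝓞 K}
    (hw : ι (α₀ : K) ^ 2 = ι (α₀ : K) - 2) (L : PeriodPair) (hg₂ : L.g₂ = 35 / 4) (hg₃ : L.g₃ = 49 / 8)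
    {z : ℂ} (horb : ∀ k : ℕ, ι (α₀ : K) ^ k * z ∉ L.lattice)
    (X : F) (hX : algClosureEmb ι (X : AlgebraicClosure K) = ℘[L] z + 1 / 4) :
    ∃ Xs : ℕ → F, Xs 0 = X ∧ ∀ k, algClosureEmb ι (Xs k : AlgebraicClosure K) = ℘[L] (ι (α₀ : K) ^ k * z) + 1 / 4 := by
  obtain ⟨Xs, h0, hs⟩ : ∃ Xs : ℕ → F, Xs 0 = X ∧ ∀ k, Xs (k + 1) =
      ((-1 - algebraMap K F (α₀ : K)) * Xs k ^ 2 + (2 * algebraMap K F (α₀ : K) - 2)) / (4 * Xs k + 3 - algebraMap K F (α₀ : K)) :=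
    ⟨fun k ↦ Nat.rec X (fun _ x ↦ ((-1 - algebraMap K F (α₀ : K)) * x ^ 2 + (2 * algebraMap K F (α₀ : K) - 2)) /
      (4 * x + 3 - algebraMap K F (α₀ : K))) k, rfl, fun _ ↦ rfl⟩
  refine ⟨Xs, h0, fun k ↦ ?_⟩
  -- the complex reading `φ = ι̂ ∘ (F ⊂ K̄)`
  have hφw : ((algClosureEmb ι).comp (algebraMap F (AlgebraicClosure K))) (algebraMap K F (α₀ : K)) = ι (α₀ : K) := by
    rw [RingHom.comp_apply, ← IsScalarTower.algebraMap_apply, algClosureEmb_algebraMap]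
  induction k with
  | zero => rw [h0, pow_zero, one_mul]; exact hX
  | succ k ih =>
    have hz : ι (α₀ : K) ^ k * z ∉ L.lattice := horb k
    have hwz : ι (α₀ : K) * (ι (α₀ : K) ^ k * z) ∉ L.lattice := by rw [← mul_assoc, ← pow_succ']; exact horb (k + 1)
    have hrec := recursion_seven hw L hg₂ hg₃ hz hwz
    have hQ := eval_seven_Qhat_ne_zero hw L hg₂ hg₃ hz hwz
    simp only [eval_add, eval_mul, eval_C, eval_X] at hQ
    have hQ' : 4 * (℘[L] (ι (α₀ : K) ^ k * z) + 1 / 4) + 3 - ι (α₀ : K) ≠ 0 := fun h ↦ hQ (by linear_combination h)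
    rw [← mul_assoc, ← pow_succ'] at hrec
    have ih' : ((algClosureEmb ι).comp (algebraMap F (AlgebraicClosure K))) (Xs k) = ℘[L] (ι (α₀ : K) ^ k * z) + 1 / 4 := ih
    change ((algClosureEmb ι).comp (algebraMap F (AlgebraicClosure K))) (Xs (k + 1)) = _
    rw [hs k, map_div₀]
    simp only [map_add, map_sub, map_mul, map_pow, map_neg, map_one, map_ofNat, hφw, ih']
    rw [div_eq_iff hQ']
    exact hrec.symm

/-! ## §3 The cores: `𝔓`-integrality of the model coordinates of a `𝔠`-division point, `v ∤ 𝔠` -/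

section Core

variable (ι : K →+* ℂ) {v : HeightOneSpectrum (𝓞 K)} {𝔪r : Ideal (𝓞 K)}
  (E : IntermediateField (v.adicCompletion K) (AlgebraicClosure (v.adicCompletion K)))
  [FiniteDimensional (v.adicCompletion K) E]
  (hE : ∀ y : AlgebraicClosure K, y ∈ rayClassField K 𝔪r → absClosureEmbedding K (v.adicCompletion K) y ∈ E)

/-- ★★ **`x(ξ z)` is `𝔓`-integral for every `𝔠`-division point `z ∈ 𝔠⁻¹L ∖ L` with `v = (α₀) ∤ 𝔠`** (de Shalit II §4.9 (i), the
torsion prime to `𝔭` injects into the reduction): an `X ∈ K(𝔪r)` reading `℘(z) + ¼` on `Λ_L = Ω·ι(𝓞_K)` lies in the reading ring of any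
finite `E ⊇ e(K(𝔪r))` — §1 orbit + §2 readings + `mem_readingRing_of_orbit`. [cite: deShalit1987, II §4.9 (i) (p. 62–63)]
[cite: SilvermanAEC2009, VII.3.1] -/
theorem mem_readingRing_of_mem_idealInvLattice
    {α₀ : 𝓞 K} (hv0 : v.asIdeal = Ideal.span {α₀}) (hw : ι (α₀ : K) ^ 2 = ι (α₀ : K) - 2) (h2E : ‖(2 : E)‖ < 1)
    (hπE : ‖(readingFieldHom E hE (algebraMap K (rayClassField K 𝔪r) (α₀ : K)) : E)‖ < 1)
    (L : PeriodPair) {Ω : ℂ} (hL : ∀ z : ℂ, z ∈ L.lattice ↔ ∃ a : 𝓞 K, z = Ω * ι (a : K)) (hg₂ : L.g₂ = 35 / 4) (hg₃ : L.g₃ = 49 / 8)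
    {𝔠 : Ideal (𝓞 K)} (h𝔠 : 𝔠 ≠ ⊥) (h𝔠v : ¬ 𝔠 ≤ v.asIdeal) {z : ℂ} (hz : z ∈ idealInvLattice ι 𝔠 L.lattice) (hzL : z ∉ L.lattice)
    (X : rayClassField K 𝔪r) (hX : algClosureEmb ι X = ℘[L] z + 1 / 4) : X ∈ readingRing E hE := by
  have horb := pow_mul_notMem_of_mem_idealInvLattice ι L hL v.isMaximal h𝔠v hv0 hz hzL
  obtain ⟨n, hn, hn1⟩ := exists_pow_sub_one_mem v.isMaximal h𝔠v h𝔠 hv0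
  have hper := pow_mul_sub_mem_of_mem_idealInvLattice ι L hn1 hz
  obtain ⟨Xs, h0, hXs⟩ := exists_orbitReadings ι (rayClassField K 𝔪r) hw L hg₂ hg₃ horb X hX
  rw [← h0]
  exact mem_readingRing_of_orbit ι E hE hw h2E hπE L hg₂ hg₃ horb hn hper Xs hXs

/-- ★ **`y(ξ z)` is `𝔓`-integral as well** (with `X`, `Y ∈ K(𝔪r)` reading both model coordinates). [cite: deShalit1987, II §4.9 (i) (p. 62–63)]
[cite: SilvermanAEC2009, VII.3.1] -/
theorem mem_readingRing_of_mem_idealInvLattice_y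
    {α₀ : 𝓞 K} (hv0 : v.asIdeal = Ideal.span {α₀}) (hw : ι (α₀ : K) ^ 2 = ι (α₀ : K) - 2) (h2E : ‖(2 : E)‖ < 1)
    (hπE : ‖(readingFieldHom E hE (algebraMap K (rayClassField K 𝔪r) (α₀ : K)) : E)‖ < 1)
    (L : PeriodPair) {Ω : ℂ} (hL : ∀ z : ℂ, z ∈ L.lattice ↔ ∃ a : 𝓞 K, z = Ω * ι (a : K)) (hg₂ : L.g₂ = 35 / 4) (hg₃ : L.g₃ = 49 / 8)
    {𝔠 : Ideal (𝓞 K)} (h𝔠 : 𝔠 ≠ ⊥) (h𝔠v : ¬ 𝔠 ≤ v.asIdeal) {z : ℂ} (hz : z ∈ idealInvLattice ι 𝔠 L.lattice) (hzL : z ∉ L.lattice)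
    {X Y : rayClassField K 𝔪r} (hX : algClosureEmb ι X = ℘[L] z + 1 / 4) (hY : algClosureEmb ι Y = (℘'[L] z - (℘[L] z + 1 / 4)) / 2) :
    Y ∈ readingRing E hE :=
  mem_readingRing_of_orbit_y ι E hE h2E L hg₂ hg₃ hzL hX hY
    (mem_readingRing_of_mem_idealInvLattice ι E hE hv0 hw h2E hπE L hL hg₂ hg₃ h𝔠 h𝔠v hz hzL X hX)

end Core

/-! ## §4 Frame bookkeeping for the oracles -/

section Frame

variable (v : HeightOneSpectrum (𝓞 K)) {α₀ : 𝓞 K}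

/-- `‖2‖ < 1` in every finite `F ⊆ K̄_v` when `2` is a uniformizer of `K_v`. [cite: SerreLocalFields1979, Ch. II §2 Cor. 3] -/
theorem norm_two_lt_one_of_isUniformizer
    (h2 : (valuation (v.adicCompletion K)).IsUniformizer ((((2 : ℕ) : 𝒪[v.adicCompletion K]) : v.adicCompletion K)))
    (F : IntermediateField (v.adicCompletion K) (AlgebraicClosure (v.adicCompletion K))) [FiniteDimensional (v.adicCompletion K) F] :
    ‖(2 : F)‖ < 1 := by
  have h := norm_algebraMap_pi_lt_one h2 F
  rwa [map_natCast, show (((2 : ℕ) : unitBall F) : F) = (2 : F) by push_cast; rfl] at h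

/-- `‖e(α₀)‖ < 1` in every reading field `F ⊇ e(K(𝔐))`, for `α₀ = u·2` a uniformizer of `K_v`. [cite: SerreLocalFields1979, Ch. II §2 Cor. 3] -/
theorem norm_readingFieldHom_algebraMap_lt_one
    (h2 : (valuation (v.adicCompletion K)).IsUniformizer ((((2 : ℕ) : 𝒪[v.adicCompletion K]) : v.adicCompletion K)))
    (u : 𝒪[v.adicCompletion K]ˣ)
    (hu : ((((u : 𝒪[v.adicCompletion K]) * ((2 : ℕ) : 𝒪[v.adicCompletion K]) : 𝒪[v.adicCompletion K]) : v.adicCompletion K)) =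
      ((α₀ : K) : v.adicCompletion K))
    {𝔐 : Ideal (𝓞 K)} (F : IntermediateField (v.adicCompletion K) (AlgebraicClosure (v.adicCompletion K)))
    [FiniteDimensional (v.adicCompletion K) F]
    (hF : ∀ y : AlgebraicClosure K, y ∈ rayClassField K 𝔐 → absClosureEmbedding K (v.adicCompletion K) y ∈ F) :
    ‖(readingFieldHom F hF (algebraMap K (rayClassField K 𝔐) (α₀ : K)) : F)‖ < 1 := by
  have h := norm_algebraMap_pi_lt_one (isUniformizer_unit_mul h2 u) F
  rw [algebraMap_integer_apply, hu] at h
  rwa [readingFieldHom_algebraMap]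

variable {v}

/-- `α₀² − α₀ + 2 = 0` read in `ℂ`: `w₀(α₀)² = w₀(α₀) − 2`. [cite: deShalit1987, II §1.10] -/
theorem embedding_sq_of_cm7 (hα₀ : α₀ ^ 2 - α₀ + 2 = 0) (ι : K →+* ℂ) : ι (α₀ : K) ^ 2 = ι (α₀ : K) - 2 := by
  have h0 : α₀ ^ 2 + 2 = α₀ := by linear_combination hα₀
  have h : (α₀ : K) ^ 2 + 2 = (α₀ : K) := by
    have h1 := congrArg (algebraMap (𝓞 K) K) h0
    rw [map_add, map_pow, map_ofNat] at h1
    exact h1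
  have h' := congrArg ι h
  rw [map_add, map_pow, map_ofNat] at h'
  linear_combination h'

variable (ι : K →+* ℂ) (L : PeriodPair) {ΩE : ℂ} (hLE : ∀ z : ℂ, z ∈ L.lattice ↔ ∃ a : 𝓞 K, z = ΩE * ι (a : K))
  (h₂ : L.g₂ = (((⟨1, -1, 0, -2, -1⟩ : WeierstrassCurve ℤ)).baseChange ℂ).c₄ / 12)
  (h₃ : L.g₃ = (((⟨1, -1, 0, -2, -1⟩ : WeierstrassCurve ℤ)).baseChange ℂ).c₆ / 216)

omit [NumberField K] in
include h₂ in
/-- `g₂ = 35/4` for the lane model. [cite: SilvermanAEC2009, III §1] -/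
theorem g₂_eq_of_cm7 : L.g₂ = 35 / 4 := by
  have hbc : ((⟨1, -1, 0, -2, -1⟩ : WeierstrassCurve ℤ).baseChange ℂ) = (⟨1, -1, 0, -2, -1⟩ : WeierstrassCurve ℂ) := cm7Model_map _
  rw [h₂, hbc, cm7Model_c₄_div_twelve]

omit [NumberField K] in
include h₃ in
/-- `g₃ = 49/8` for the lane model. [cite: SilvermanAEC2009, III §1] -/
theorem g₃_eq_of_cm7 : L.g₃ = 49 / 8 := by
  have hbc : ((⟨1, -1, 0, -2, -1⟩ : WeierstrassCurve ℤ).baseChange ℂ) = (⟨1, -1, 0, -2, -1⟩ : WeierstrassCurve ℂ) := cm7Model_map _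
  rw [h₃, hbc, cm7Model_c₆_div]

omit [NumberField K] in
/-- The model `x`-coordinate `℘ − b₂/12` is `℘ + ¼`. [cite: SilvermanAEC2009, III §1] -/
theorem modelX_eq (z : ℂ) :
    ℘[L] z - (((⟨1, -1, 0, -2, -1⟩ : WeierstrassCurve ℤ)).baseChange ℂ).b₂ / 12 = ℘[L] z + 1 / 4 := by
  have hbc : ((⟨1, -1, 0, -2, -1⟩ : WeierstrassCurve ℤ).baseChange ℂ) = (⟨1, -1, 0, -2, -1⟩ : WeierstrassCurve ℂ) := cm7Model_map _
  rw [hbc, cm7Model_b₂_div_twelve]; ring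

omit [NumberField K] in
/-- The model `y`-coordinate `(℘′ − a₁x − a₃)/2` is `(℘′ − (℘ + ¼))/2`. [cite: SilvermanAEC2009, III §1] -/
theorem modelY_eq (z : ℂ) :
    (℘'[L] z - (((⟨1, -1, 0, -2, -1⟩ : WeierstrassCurve ℤ)).baseChange ℂ).a₁ *
        (℘[L] z - (((⟨1, -1, 0, -2, -1⟩ : WeierstrassCurve ℤ)).baseChange ℂ).b₂ / 12) -
          (((⟨1, -1, 0, -2, -1⟩ : WeierstrassCurve ℤ)).baseChange ℂ).a₃) / 2 =
      (℘'[L] z - (℘[L] z + 1 / 4)) / 2 := by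
  have hbc : ((⟨1, -1, 0, -2, -1⟩ : WeierstrassCurve ℤ).baseChange ℂ) = (⟨1, -1, 0, -2, -1⟩ : WeierstrassCurve ℂ) := cm7Model_map _
  rw [hbc, cm7Model_b₂_div_twelve]
  change (℘'[L] z - 1 * (℘[L] z - -1 / 4) - 0) / 2 = _
  ring

end Frame

end Summit.BirchSwinnertonDyer.BirchSwinnertonDyer.Theorems.PrintCf2.KatzMeasureJZeroSeam

end
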